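/-
Copyright (c) 2026 the pub-hodgecm-mathlib formalisation cell (harness21).  Prover seat hodgecm-mathlib-LH7-p10 (g2), req620 Track A «(D-RAM) FOUR-FRAME» squad
((β₂) road (R-36) «PURE-CELL LEDGER», lane C = type RamM: the PARITY GATE ‹PAR_C› of LH4-p12 (g8)'s (OFF_C) dispatch ★ p863526 — the lane-C twin of ★
`F0P3cDyRamRowCleanCellBit.depth_mod_two_eq` (LH4-p06 (g9)); β₂ WORD #18 (0) pattern; LH4-p16 (g2)'s parity rider 23:13:41Z), 2026-09-05.
-/
import Summits.HodgeConjecture.HodgeConjecture.Theorems.F0P3cDyRamNormOneSqDepthParity    -- ★ p854642 (B-p04): `normOneSq_depth_parity`; brings ★ `v_eq_one_of_mul_map_eq_one`, ★ DEFS `IsRamifiedQuadraticDatum`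
import HarnessLib

/-!
# Crux `H413`, line LH4 «(D-RAM) FOUR-FRAME» — (β₂) road, lane C (type RamM): «THE CONE DEPTH IS EVEN» — at a ramified quadratic datum `(Θ, ϖM, d_Θ, t)` on `M`, a Θ-norm-one
# `lam` and a σ-norm-one `u₀ ∈ E` with `|lam − jE u₀| = exp(−m)`, `t < m` have `m ≡ d_Θ (mod 2)`; in the RamM lane `d_Θ = 2g`, `t = 2t_E`, so `m` is EVEN

Cell `hodgecm-mathlib` (D-0151), FLOOR 0, crux item H413 = `stmt-HodgeConjecture-24833`, route of record `HCCMUnconditional`; squads F0∕P3c∕LH4 + LH7; lane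
`--supports stmt-HodgeConjecture-24833 --as helper` (count-neutral; pays NO tier-0 row).  THEOREMS ONLY (no `def`, no instance, no notation, no `sorry`, default heartbeats);
★-only imports; states NO law; NO CM token: one abstract pair of valued fields `jE : E → M` with involutions `σ`, `Θ` (`Θ ∘ jE = jE ∘ σ`).

WHY.  LH4-p12 (g8)'s lane-C (OFF_C) dispatch ★ p863526 `cellDiff_offRowC_eq_zero_of_pieces (N) ⟨‹OFF_C.letter.v2› binders⟩ (hparC : m % 2 = 0) (hEvenRowC) (hTopC) (hLowC)` carries
the parity of the cone depth `m = v_M(lam − jE u₀₀)` as ONE ℕ hypothesis; its wrapper `offRowC_holds_of_lines (N) (hpar : ‹PAR_C›) …` wants ‹PAR_C› = «`m % 2 = 0` for every block».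
THIS FILE is the block-free HEAD that pays it, exactly as ★ `depth_mod_two_eq` (LH4-p06 (g9), `F0P3cDyRamRowCleanCellBit`) pays lane B's `hpar : m % 2 = d % 2` in ★
`offRow_holds₂_of_lines`: the SAME argument at the M-side uniformiser `ϖM` instead of `jE ϖ`.
* `depth_mod_two_eq_ramM` — datum `(Θ, ϖM, d_Θ, t)` (any uniformiser of `M`, any `t` with `|2| = |ϖM|^t`), `Θ lam·lam = 1`, `u₀·σu₀ = 1`, `|lam − jE u₀| = exp(−m)`, `t < m` ⟹
  `m % 2 = d_Θ % 2`.  PROOF (★ p854642's route): `ν := lam ∕ jE u₀` is Θ-norm-one with `|ν − 1| = exp(−m)`; `|ν + 1| = |2 + (ν − 1)| = |2| = exp(−t)` (`t < m`); so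
  `|ν² − 1| = |ϖM|^{m + t}` and ★ `normOneSq_depth_parity` gives `m + t ≡ d_Θ`; `t` is even (`2` is Θ-fixed, Θ-fixed elements have even order). [Serre1979, Ch. V §3 Cor. 3]
* `depth_even_ramM` — the RamM reading: with ‹OFF_C›'s `_c8 : IsRamifiedQuadraticDatum Θ ϖM dΘ (2 * tE)` and `_c21 : dΘ = 2 * g`, `2·t_E < m ⟹ m % 2 = 0`.  In the wrapper:
  `hΘj := _hΘj`, `hΘlam := _hΘlam`, `huu := ★ line_entry_mul_map_eq_one σ (h_W ≠ 0) _hA _hΓ`, `hm := _hm`, and `2·tE < m` from the fence `_hNm : N d tE ≤ m` under the ONE floor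
  `2·tE + 1 ≤ N d tE` (N-discipline, β₂ WORD #19 (2); lane B's floor was `tE + 1 ≤ N`).
HONEST LABEL.  Valuation arithmetic only; nothing printed is asserted; no census law is stated; ‹OFF_C›'s three cell sockets, ‹ROW_C›, (β₂) stay HYPOTHESES; `HC_CM` is proved only
modulo the 7 printed citations (2 remaining named inputs: hLiu418 = `stmt-HodgeConjecture-24832`, h413 = `stmt-HodgeConjecture-24833`) until rung 0 closes.
## References
* [Serre1979] J.-P. Serre, *Local Fields*, GTM 67 (1979): Ch. V §3 Prop. 5, Cor. 3 pp. 84–86 (the different of a ramified quadratic extension; norm-one units).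
* [Rogawski1990] J. D. Rogawski, *Automorphic Representations of Unitary Groups in Three Variables*, Ann. of Math. Stud. 123 (1990): §4.9 p. 55.
* [Kottwitz1986BaseChangeUnits] R. E. Kottwitz, *Base change for unit elements of Hecke algebras*, Compositio Math. 60 (1986): §1 pp. 240–241.
-/

set_option autoImplicit false

noncomputable section

namespace Summit.HodgeConjecture.HodgeConjecture.Cruxes.H413.F0P3cDyRamDepthEvenRamM

open scoped Valued WithZero
open WithZero
open Literature.NumberTheory.Automorphic Literature.NumberTheory.Automorphic.UnitaryThreeFourFrame
open Summit.HodgeConjecture.HodgeConjecture.Cruxes.H413.F0P3cDyRamNormOneSqDepthParity (normOneSq_depth_parity)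

variable {E M : Type} [Field E] [Field M] [Valued M ℤᵐ⁰] {σ : E →+* E} {Θ : M →+* M}

/-- **THE CONE DEPTH HAS THE PARITY OF THE Θ-DIFFERENT** (lane-C twin of ★ `depth_mod_two_eq`, at an arbitrary uniformiser `ϖM` of `M`): for a ramified quadratic datum
`(Θ, ϖM, d_Θ, t)`, `Θ lam·lam = 1`, `u₀·σu₀ = 1` (`Θ ∘ jE = jE ∘ σ`), `|lam − jE u₀| = exp(−m)` and `t < m`: `m % 2 = d_Θ % 2`.  (`ν = lam∕jE u₀` is Θ-norm-one, `|ν − 1| = exp(−m)`,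
`|ν + 1| = |2| = exp(−t)`, so `|ν² − 1| = |ϖM|^{m+t}` and ★ `normOneSq_depth_parity` applies; `t` is even since `2` is Θ-fixed.) [cite: Serre1979, Ch. V §3 Prop. 5, Cor. 3 pp. 84–86] -/
theorem depth_mod_two_eq_ramM [CompleteSpace M] (jE : E →+* M) (hΘj : ∀ c, Θ (jE c) = jE (σ c)) {ϖM : M} {dΘ t : ℕ}
    (hDM : IsRamifiedQuadraticDatum Θ ϖM dΘ t) {lam : M} (hΘlam : Θ lam * lam = 1) {u₀ : E} (huu : u₀ * σ u₀ = 1)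
    {m : ℕ} (hm : Valued.v (lam - jE u₀) = WithZero.exp (-(m : ℤ))) (htm : t < m) : m % 2 = dΘ % 2 := by
  obtain ⟨hΘΘ, hvΘ, hπ, heven, -, -, h2⟩ := id hDM
  have hu0 : jE u₀ ≠ 0 := fun h0 => by
    have := congrArg jE huu; rw [map_mul, map_one, ← hΘj, h0, zero_mul] at this; exact zero_ne_one this
  have hΘu : jE u₀ * Θ (jE u₀) = 1 := by rw [hΘj, ← map_mul, huu, map_one]
  have hlamΘ : lam * Θ lam = 1 := by rw [mul_comm]; exact hΘlam
  set ν : M := lam / jE u₀ with hν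
  have hνu : ν * Θ ν = 1 := by rw [hν, map_div₀, div_mul_div_comm, hlamΘ, hΘu, div_one]
  have hvu : Valued.v (jE u₀) = 1 := v_eq_one_of_mul_map_eq_one hvΘ hΘu
  have hν1 : Valued.v (ν - 1) = exp (-(m : ℤ)) := by
    rw [hν, div_sub_one hu0, Valuation.map_div, hvu, div_one, hm]
  -- `t` is even and `|2| = exp(−t)`
  have hv2 : Valued.v (2 : M) = exp (-(t : ℤ)) := by rw [h2, hπ, ← exp_nsmul, nsmul_eq_mul, mul_neg, mul_one]
  have ht2 : t % 2 = 0 := by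
    obtain ⟨n, hn⟩ := heven 2 (map_ofNat Θ 2) (fun h0 => by rw [h0, map_zero] at hv2; exact (exp_ne_zero hv2.symm).elim)
    rw [hv2] at hn; have := exp_injective hn; omega
  -- `|ν + 1| = |2|` and `|ν·ν − 1| = |ϖM|^{m + t}`
  have hν2 : Valued.v (ν + 1) = exp (-(t : ℤ)) := by
    have e : ν + 1 = 2 + (ν - 1) := by ring
    rw [e, Valuation.map_add_eq_of_lt_left _ (by rw [hv2, hν1, exp_lt_exp]; omega), hv2]
  have hsq : Valued.v (ν * ν - 1) = Valued.v ϖM ^ (m + t) := by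
    rw [show ν * ν - 1 = (ν - 1) * (ν + 1) by ring, Valuation.map_mul, hν1, hν2, hπ, ← exp_add, ← exp_nsmul]
    congr 1; simp only [nsmul_eq_mul]; push_cast; ring
  have hne : ν * ν ≠ 1 := fun h1 => by
    have := congrArg Valued.v (sub_eq_zero.2 h1); rw [hsq, Valuation.map_zero] at this
    exact pow_ne_zero _ (by rw [hπ]; exact exp_ne_zero) this
  have hpar := normOneSq_depth_parity Θ ϖM dΘ t hDM ν hνu hne (m + t) hsq
  omega

/-- **THE RamM CONE DEPTH IS EVEN** (the head of ‹PAR_C›): with ‹OFF_C.letter.v2›'s `_c8 : IsRamifiedQuadraticDatum Θ ϖM dΘ (2 * tE)` and `_c21 : dΘ = 2 * g`, a Θ-norm-one `lam`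
and a σ-norm-one `u₀` with `|lam − jE u₀| = exp(−m)`, `2·t_E < m` give `m % 2 = 0` (the lane-C live row `4b + 2(d % 2) = m` is even; odd `m` never occurs below the fence).
[cite: Serre1979, Ch. V §3 Prop. 5, Cor. 3 pp. 84–86] [cite: Kottwitz1986BaseChangeUnits, §1 pp. 240–241] -/
theorem depth_even_ramM [CompleteSpace M] (jE : E →+* M) (hΘj : ∀ c, Θ (jE c) = jE (σ c)) {ϖM : M} {dΘ tE g : ℕ}
    (c8 : IsRamifiedQuadraticDatum Θ ϖM dΘ (2 * tE)) (c21 : dΘ = 2 * g) {lam : M} (hΘlam : Θ lam * lam = 1) {u₀ : E} (huu : u₀ * σ u₀ = 1)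
    {m : ℕ} (hm : Valued.v (lam - jE u₀) = WithZero.exp (-(m : ℤ))) (htm : 2 * tE < m) : m % 2 = 0 := by
  have h := depth_mod_two_eq_ramM jE hΘj c8 hΘlam huu hm htm
  omega

end Summit.HodgeConjecture.HodgeConjecture.Cruxes.H413.F0P3cDyRamDepthEvenRamM

end
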